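import Summits.ValiantsHypothesis.ValiantsHypothesis.Theorems.FeketeSOSFeketeSOSHardPaleyRIPIntervalFlat
import Mathlib.Algebra.Polynomial.Eval.Degree
import Mathlib.Analysis.InnerProductSpace.Basic

/-!
# Route FeketeSOS — crux `FeketeSOSHard` (stmt-ValiantsHypothesis-3996), line `paley-rip` v3,
# `stub_tameOperator` piece (B): exponential patterns on an interval block are cheap (polylog mass)

The "R_k lemma" consequence that the `r = 2` programme needs (`Cruxes/FeketeSOSHard/Lines/paley-rip-stub3-census.md`
§5 "R-trick", §6 (B)): on a sum-block `(d + H) + (d' + H)`, `H = [0,k)`, every exponential pattern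
`n ↦ u^n` (`|u| = 1`) — hence every narrow-band block, by superposition over its Fourier expansion — has a
cheap preimage: weighted squares supported in `(d + H) ∪ (d' + H)` of archimedean mass `O(log k)·(ℓ¹ of the
Fourier coefficients)`.  From `flat_rep` (`…PaleyRIPIntervalFlat.lean`, the dyadic Fejér partition of unity,
mass `≤ Nat.log 2 k + 5/2` — sharper than the `log² k` the census assumed) by three transports that do not
change the mass:

* `rep_twist`       — `X ↦ uX` (`|u| = 1`) turns the all-ones pattern into `Σ u^n X^n` (`exp_rep`);
* `rep_shift_two`   — polarisation `c·X^d w·X^{d'} w = (c/4)(X^d w + X^{d'} w)² − (c/4)(X^d w − X^{d'} w)²` and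
                      the parallelogram law move the squares onto the two blocks (`exp_block_rep`);
* `rep_smul` + `rep_sum` — superposition (`exp_block_superposition_rep`:
                      mass `≤ (Σ_ξ |a_ξ|)(Nat.log 2 k + 5/2)`);
* `exp_block_rep_cyclic` — the same in the exact (cyclic, `X^p − 1 ∣ …`) vocabulary of `stub_tameOperator`.

Honest framing (rung currency): Theorems-side helper `--supports` stmt-3996 for the structured part of a
support (`S ⊇` an interval block); it says nothing about unstructured supports, `stub_tameOperator` (r ≥ 2),
`stub_paleyFlatRIP` or the crux, which stay OPEN; `VP ≠ VNP` is untouched.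
-/

set_option linter.dupNamespace false

namespace Summit.ValiantsHypothesis.ValiantsHypothesis.Theorems.FeketeSOSHardPaleyRIP

open Polynomial Finset
open scoped BigOperators

noncomputable section

/-! ## Twisting, scaling, shifting: exponential patterns and superposition -/

/-- Twisting `X ↦ uX` by a unimodular `u` preserves the mass of a weighted square. [folklore] -/
theorem sqMass_comp_C_mul_X (c : ℂ) (w : ℂ[X]) (u : ℂ) (hu : ‖u‖ = 1) :
    sqMass c (w.comp (C u * X)) = sqMass c w := by
  have hsub : (w.comp (C u * X)).support ⊆ w.support := by
    intro n hn
    rw [mem_support_iff, comp_C_mul_X_coeff] at hn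
    exact mem_support_iff.2 fun h0 => hn (by rw [h0, zero_mul])
  rw [sqMass_eq_of_support_subset c _ w.support hsub]
  unfold sqMass
  congr 1
  refine Finset.sum_congr rfl fun a _ => ?_
  rw [comp_C_mul_X_coeff, norm_mul, norm_pow, hu, one_pow, mul_one]

/-- **Twist.**  A representation of `F` by weighted squares supported in `T` twists to one of `F(uX)`
with the same supports and, for `|u| = 1`, the same mass. [folklore] -/
theorem rep_twist {T : Finset ℕ} {F : ℂ[X]} {m : ℝ} (u : ℂ) (hu : ‖u‖ = 1)
    (h : ∃ (s : ℕ) (c : Fin s → ℂ) (w : Fin s → ℂ[X]), (∀ j, (w j).support ⊆ T) ∧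
      (∑ j, C (c j) * w j ^ 2) = F ∧ (∑ j, sqMass (c j) (w j)) ≤ m) :
    ∃ (s : ℕ) (c : Fin s → ℂ) (w : Fin s → ℂ[X]), (∀ j, (w j).support ⊆ T) ∧
      (∑ j, C (c j) * w j ^ 2) = F.comp (C u * X) ∧ (∑ j, sqMass (c j) (w j)) ≤ m := by
  obtain ⟨s, c, w, h1, h2, h3⟩ := h
  refine ⟨s, c, fun j => (w j).comp (C u * X), ?_, ?_, ?_⟩
  · intro j n hn
    rw [mem_support_iff, comp_C_mul_X_coeff] at hn
    exact h1 j (mem_support_iff.2 fun h0 => hn (by rw [h0, zero_mul]))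
  · rw [← h2, Polynomial.sum_comp]
    exact Finset.sum_congr rfl fun j _ => by rw [mul_comp, C_comp, pow_comp]
  · simpa only [sqMass_comp_C_mul_X _ _ u hu] using h3

/-- **Scaling.**  Multiplying the weights by `a` represents `a · F` at `|a|` times the mass. [folklore] -/
theorem rep_smul {T : Finset ℕ} {F : ℂ[X]} {m : ℝ} (a : ℂ)
    (h : ∃ (s : ℕ) (c : Fin s → ℂ) (w : Fin s → ℂ[X]), (∀ j, (w j).support ⊆ T) ∧
      (∑ j, C (c j) * w j ^ 2) = F ∧ (∑ j, sqMass (c j) (w j)) ≤ m) :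
    ∃ (s : ℕ) (c : Fin s → ℂ) (w : Fin s → ℂ[X]), (∀ j, (w j).support ⊆ T) ∧
      (∑ j, C (c j) * w j ^ 2) = C a * F ∧ (∑ j, sqMass (c j) (w j)) ≤ ‖a‖ * m := by
  obtain ⟨s, c, w, h1, h2, h3⟩ := h
  refine ⟨s, fun j => a * c j, w, h1, ?_, ?_⟩
  · rw [← h2, Finset.mul_sum]
    exact Finset.sum_congr rfl fun j _ => by rw [C_mul]; ring
  · have : ∀ j, sqMass (a * c j) (w j) = ‖a‖ * sqMass (c j) (w j) := fun j => by
      unfold sqMass; rw [norm_mul, mul_assoc]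
    simp_rw [this, ← Finset.mul_sum]
    exact mul_le_mul_of_nonneg_left h3 (norm_nonneg a)

/-- The twisted all-ones pattern is the exponential pattern: `(Σ_{n<m} X^n)(uX) = Σ_{n<m} u^n X^n`. [folklore] -/
theorem box_comp_C_mul_X (m : ℕ) (u : ℂ) :
    (∑ n ∈ range m, (X : ℂ[X]) ^ n).comp (C u * X) = ∑ n ∈ range m, C (u ^ n) * (X : ℂ[X]) ^ n := by
  rw [Polynomial.sum_comp]
  exact Finset.sum_congr rfl fun n _ => by rw [pow_comp, X_comp, mul_pow, C_pow]

/-- **Exponential interval patterns are cheap.**  For `k ≥ 1` and `|u| = 1`, the pattern `Σ_{n<2k−1} u^n X^n`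
is `Σ_j c_j w_j²` with `supp w_j ⊆ [0,k)` and mass `≤ Nat.log 2 k + 5/2`. [folklore] -/
theorem exp_rep (k : ℕ) (hk : 1 ≤ k) (u : ℂ) (hu : ‖u‖ = 1) :
    ∃ (s : ℕ) (c : Fin s → ℂ) (w : Fin s → ℂ[X]), (∀ j, (w j).support ⊆ range k) ∧
      (∑ j, C (c j) * w j ^ 2) = ∑ n ∈ range (2 * k - 1), C (u ^ n) * (X : ℂ[X]) ^ n ∧
      (∑ j, sqMass (c j) (w j)) ≤ (Nat.log 2 k : ℝ) + 5 / 2 :=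
  rep_congr (box_comp_C_mul_X _ u) le_rfl (rep_twist u hu (flat_rep k hk))

/-- Support of a shift: if `supp w ⊆ [0,k)` then every exponent of `X^d w` is `d + i` with `i < k`. [folklore] -/
theorem exists_lt_of_mem_support_X_pow_mul {k d : ℕ} {w : ℂ[X]} (hw : w.support ⊆ range k) {n : ℕ}
    (hn : n ∈ (X ^ d * w).support) : ∃ i, i < k ∧ n = d + i := by
  rw [mem_support_iff, coeff_X_pow_mul'] at hn
  by_cases hd : d ≤ n
  · rw [if_pos hd] at hn
    exact ⟨n - d, mem_range.1 (hw (mem_support_iff.2 hn)), by omega⟩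
  · exact absurd (if_neg hd) hn

/-- The `ℓ²`-mass of the coefficients is shift invariant (summed over any superset of the support). [folklore] -/
theorem sum_normSq_coeff_X_pow_mul (d : ℕ) (w : ℂ[X]) (T' : Finset ℕ) (hT' : (X ^ d * w).support ⊆ T') :
    ∑ n ∈ T', ‖(X ^ d * w).coeff n‖ ^ 2 = ∑ a ∈ w.support, ‖w.coeff a‖ ^ 2 := by
  have step : ∑ a ∈ w.support, ‖w.coeff a‖ ^ 2 =
      ∑ n ∈ w.support.map (addRightEmbedding d), ‖(X ^ d * w).coeff n‖ ^ 2 := by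
    rw [Finset.sum_map]
    refine Finset.sum_congr rfl fun a _ => ?_
    rw [addRightEmbedding_apply, coeff_X_pow_mul]
  rw [step]
  symm
  refine Finset.sum_subset ?_ ?_
  · intro n hn
    obtain ⟨a, ha, rfl⟩ := Finset.mem_map.1 hn
    refine hT' (mem_support_iff.2 ?_)
    rw [addRightEmbedding_apply, coeff_X_pow_mul]
    exact mem_support_iff.1 ha
  · intro n _ hn
    rw [coeff_X_pow_mul']
    by_cases hd : d ≤ n
    · rw [if_pos hd]
      have : n - d ∉ w.support := fun h => hn (Finset.mem_map.2 ⟨n - d, h, by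
        rw [addRightEmbedding_apply]; omega⟩)
      rw [notMem_support_iff.1 this, norm_zero]
      ring
    · rw [if_neg hd, norm_zero]
      ring

/-- **Two-sided shift (polarisation).**  A representation of `F` by squares supported in `[0,k)` yields, for
any `d, d'` and any `T ⊇ (d + [0,k)) ∪ (d' + [0,k))`, a representation of `X^{d+d'} F` by squares supported in
`T` of the same mass: `c X^d w · X^{d'} w = (c/4)(X^d w + X^{d'} w)² − (c/4)(X^d w − X^{d'} w)²` and the
parallelogram law. [folklore] -/
theorem rep_shift_two {k : ℕ} {F : ℂ[X]} {m : ℝ} (d d' : ℕ) (T : Finset ℕ)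
    (hd : ∀ i, i < k → d + i ∈ T) (hd' : ∀ i, i < k → d' + i ∈ T)
    (h : ∃ (s : ℕ) (c : Fin s → ℂ) (w : Fin s → ℂ[X]), (∀ j, (w j).support ⊆ range k) ∧
      (∑ j, C (c j) * w j ^ 2) = F ∧ (∑ j, sqMass (c j) (w j)) ≤ m) :
    ∃ (s : ℕ) (c : Fin s → ℂ) (w : Fin s → ℂ[X]), (∀ j, (w j).support ⊆ T) ∧
      (∑ j, C (c j) * w j ^ 2) = X ^ (d + d') * F ∧ (∑ j, sqMass (c j) (w j)) ≤ m := by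
  obtain ⟨s, c, w, h1, h2, h3⟩ := h
  -- supports of the shifted squares
  have hsd : ∀ j, (X ^ d * w j).support ⊆ T := fun j n hn => by
    obtain ⟨i, hi, rfl⟩ := exists_lt_of_mem_support_X_pow_mul (h1 j) hn
    exact hd i hi
  have hsd' : ∀ j, (X ^ d' * w j).support ⊆ T := fun j n hn => by
    obtain ⟨i, hi, rfl⟩ := exists_lt_of_mem_support_X_pow_mul (h1 j) hn
    exact hd' i hi
  have hsp : ∀ j, (X ^ d * w j + X ^ d' * w j).support ⊆ T := fun j =>
    (support_add).trans (Finset.union_subset (hsd j) (hsd' j))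
  have hsm : ∀ j, (X ^ d * w j - X ^ d' * w j).support ⊆ T := fun j => by
    rw [sub_eq_add_neg]
    refine (support_add).trans (Finset.union_subset (hsd j) ?_)
    rw [support_neg]; exact hsd' j
  -- one polarised square pair per old square
  have hone : ∀ j, ∃ (s' : ℕ) (c' : Fin s' → ℂ) (w' : Fin s' → ℂ[X]), (∀ i, (w' i).support ⊆ T) ∧
      (∑ i, C (c' i) * w' i ^ 2) = X ^ (d + d') * (C (c j) * w j ^ 2) ∧
      (∑ i, sqMass (c' i) (w' i)) ≤ sqMass (c j) (w j) := by
    intro j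
    have hp := rep_single T (c j / 4) _ (hsp j) le_rfl
    have hm := rep_single T (-(c j / 4)) _ (hsm j) le_rfl
    refine rep_congr ?_ ?_ (rep_add hp hm)
    · have h4 : C ((4 : ℂ)⁻¹) * 4 = (1 : ℂ[X]) := by
        rw [show (4 : ℂ[X]) = C (4 : ℂ) from rfl, ← C_mul, inv_mul_cancel₀ (by norm_num), C_1]
      rw [C_neg, div_eq_mul_inv, C_mul]
      linear_combination (C (c j) * X ^ (d + d') * w j ^ 2) * h4
    · -- parallelogram law + shift invariance
      rw [sqMass_eq_of_support_subset _ _ T (hsp j), sqMass_eq_of_support_subset _ _ T (hsm j), norm_neg,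
        ← mul_add, ← Finset.sum_add_distrib]
      have hpar : ∀ n ∈ T, ‖(X ^ d * w j + X ^ d' * w j).coeff n‖ ^ 2 + ‖(X ^ d * w j - X ^ d' * w j).coeff n‖ ^ 2
          = 2 * (‖(X ^ d * w j).coeff n‖ ^ 2 + ‖(X ^ d' * w j).coeff n‖ ^ 2) := by
        intro n _
        rw [coeff_add, coeff_sub]
        have := parallelogram_law_with_norm ℂ ((X ^ d * w j).coeff n) ((X ^ d' * w j).coeff n)
        nlinarith [this]
      rw [Finset.sum_congr rfl hpar, ← Finset.mul_sum, Finset.sum_add_distrib,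
        sum_normSq_coeff_X_pow_mul d (w j) T (hsd j), sum_normSq_coeff_X_pow_mul d' (w j) T (hsd' j)]
      unfold sqMass
      rw [norm_div, show ‖(4 : ℂ)‖ = 4 by simp]
      apply le_of_eq
      ring
  have hall := rep_sum (Finset.univ : Finset (Fin s)) T (fun j => X ^ (d + d') * (C (c j) * w j ^ 2))
    (fun j => sqMass (c j) (w j)) fun j _ => hone j
  refine rep_congr ?_ h3 hall
  rw [← Finset.mul_sum, h2]

/-- **Exponential patterns on a two-sided interval block are cheap.**  For `k ≥ 1`, `|u| = 1`, shifts `d, d'`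
and any `S ⊇ (d + [0,k)) ∪ (d' + [0,k))`: the pattern `X^{d+d'} Σ_{n<2k−1} u^n X^n` (an exponential on the
sum-block `(d + H) + (d' + H)`, `H = [0,k)`) is `Σ_j c_j w_j²` with `supp w_j ⊆ S` and mass
`≤ Nat.log 2 k + 5/2`. [folklore] -/
theorem exp_block_rep (k : ℕ) (hk : 1 ≤ k) (u : ℂ) (hu : ‖u‖ = 1) (d d' : ℕ) (S : Finset ℕ)
    (hd : ∀ i, i < k → d + i ∈ S) (hd' : ∀ i, i < k → d' + i ∈ S) :
    ∃ (s : ℕ) (c : Fin s → ℂ) (w : Fin s → ℂ[X]), (∀ j, (w j).support ⊆ S) ∧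
      (∑ j, C (c j) * w j ^ 2) = X ^ (d + d') * ∑ n ∈ range (2 * k - 1), C (u ^ n) * (X : ℂ[X]) ^ n ∧
      (∑ j, sqMass (c j) (w j)) ≤ (Nat.log 2 k : ℝ) + 5 / 2 :=
  rep_shift_two d d' S hd hd' (exp_rep k hk u hu)

/-- **Superposition** ("`μ_H(g) ≤ (‖ĝ‖₁/N)(log₂ k + O(1))`").  Any finite combination
`Σ_{ξ∈I} a_ξ · X^{d+d'} Σ_{n<2k−1} u_ξ^n X^n` of exponential patterns (`|u_ξ| = 1`) on the block is represented by
squares supported in `S ⊇ (d + [0,k)) ∪ (d' + [0,k))` at mass `≤ (Σ_ξ |a_ξ|)(Nat.log 2 k + 5/2)`. [folklore] -/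
theorem exp_block_superposition_rep {ι : Type*} (I : Finset ι) (a : ι → ℂ) (u : ι → ℂ)
    (hu : ∀ ξ ∈ I, ‖u ξ‖ = 1) (k : ℕ) (hk : 1 ≤ k) (d d' : ℕ) (S : Finset ℕ)
    (hd : ∀ i, i < k → d + i ∈ S) (hd' : ∀ i, i < k → d' + i ∈ S) :
    ∃ (s : ℕ) (c : Fin s → ℂ) (w : Fin s → ℂ[X]), (∀ j, (w j).support ⊆ S) ∧
      (∑ j, C (c j) * w j ^ 2) =
        ∑ ξ ∈ I, C (a ξ) * (X ^ (d + d') * ∑ n ∈ range (2 * k - 1), C (u ξ ^ n) * (X : ℂ[X]) ^ n) ∧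
      (∑ j, sqMass (c j) (w j)) ≤ (∑ ξ ∈ I, ‖a ξ‖) * ((Nat.log 2 k : ℝ) + 5 / 2) := by
  rw [Finset.sum_mul]
  exact rep_sum I S _ _ fun ξ hξ => rep_smul (a ξ) (exp_block_rep k hk (u ξ) (hu ξ hξ) d d' S hd hd')

/-- **In the exact vocabulary of `stub_tameOperator`** (cyclic form; the representation is even exact): for a
prime `p`, `S ⊆ ℕ` containing the blocks `d + [0,k)` and `d' + [0,k)`, and `|u| = 1`, the exponential
sum-block pattern `F = X^{d+d'} Σ_{n<2k−1} u^n X^n` has weighted squares supported in `S` with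
`X^p − 1 ∣ Σ_j c_j w_j² − F` and mass `≤ Nat.log 2 k + 5/2` — polylogarithmic in the block length, as piece (B)
of the census requires. [folklore] -/
theorem exp_block_rep_cyclic (p : ℕ) (k : ℕ) (hk : 1 ≤ k) (u : ℂ) (hu : ‖u‖ = 1) (d d' : ℕ)
    (S : Finset ℕ) (hd : ∀ i, i < k → d + i ∈ S) (hd' : ∀ i, i < k → d' + i ∈ S) :
    ∃ (s : ℕ) (c : Fin s → ℂ) (w : Fin s → ℂ[X]), (∀ j, (w j).support ⊆ S) ∧
      ((X : ℂ[X]) ^ p - 1 ∣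
        (∑ j, C (c j) * w j ^ 2) - X ^ (d + d') * ∑ n ∈ range (2 * k - 1), C (u ^ n) * (X : ℂ[X]) ^ n) ∧
      (∑ j, sqMass (c j) (w j)) ≤ (Nat.log 2 k : ℝ) + 5 / 2 := by
  obtain ⟨s, c, w, h1, h2, h3⟩ := exp_block_rep k hk u hu d d' S hd hd'
  exact ⟨s, c, w, h1, by rw [h2, sub_self]; exact dvd_zero _, h3⟩

end

end Summit.ValiantsHypothesis.ValiantsHypothesis.Theorems.FeketeSOSHardPaleyRIP
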